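/-
Copyright (c) 2026 the pub-hodgecm-mathlib formalisation cell (harness21).  Prover seat hodgecm-mathlib-K2E5-p16 (g6), Track B «K2-LIT»,
#184♮ = hLiu418 = `stmt-HodgeConjecture-24832`; #42S organ S2 (RULING «M-158f», DESIGN-S2 41bd43fff4457fcc §3 (ii) ∕ §4 row S2-P), file S2-P
PART C `K2LiuU22CompactPicturePOperatorsExp`: EXISTENCE of the Shilov velocity (calculus of the matrix inverse), and the headline instance
`h_t = k_u · exp(tX)` — `d∕dt|₀ A(k_u exp(tX)) = ((m∕2 − k)·τ_X(u) + (m∕2)·conj τ_X(u))·A(k_u) + d∕dt|₀ A(k_{v_t})`, `τ_X(u) = tr denom (k_uX) (−i1)`,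
with `v_t` entrywise differentiable at `0` and velocity `V_X(u) = denom (k_uX) (i1) − denom (k_uX) (−i1)·u`.  THEOREMS ONLY (no `def`, no `instance`,
no notation, no named-fact hypothesis, no `sorry`; generic rank `l`).
-/
import Summits.HodgeConjecture.HodgeConjecture.Theorems.K2LiuU22CompactPicturePOperators    -- S2-P part B (this seat)
import Mathlib.Analysis.Calculus.FDeriv.Mul
import HarnessLib

/-!
# Crux `HLiu418`, organ S2, S2-P part C: the Shilov velocity exists; the instance `k_u · exp(tX)`

Cell `hodgecm-mathlib`, crux item hLiu418 = `stmt-HodgeConjecture-24832` (helper lane `--supports`, count-neutral).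

* §1 `hasDerivAt_exp_smul_entry` (generic rank twin of ★ p859609's `Fin 2 ⊕ Fin 2` lemma), `hasDerivAt_inv_entry` (entries of `t ↦ (D_t)⁻¹`:
  derivative `−D₀⁻¹ D′ D₀⁻¹`, via Mathlib `hasFDerivAt_ringInverse` in the `L^∞`-operator normed ring), and **`hasDerivAt_shilov_entry`**: along an
  entrywise differentiable curve `h_t` with `h₀ ∈ U(J)` the Shilov coordinate `v_t = (denom h_t (−i1))⁻¹ denom h_t (i1)` is entrywise differentiable
  at `0` with velocity `D⁻⁻¹ (W⁺ − W⁻ v₀)`, `W^± = denom h′₀ (±i1)` — discharging the hypothesis `hV` of part B's `shilov_velocity_eq`.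
* §2 `archScalarSection_kU_reflect` (`f⁰(k_u · diag(−1,1)) = 1`) and **`hasDerivAt_section_kU_exp`**: for `A ∈ I_w(s, χ_k)`, unitary `u`, and `X`
  with `exp(tX) ∈ U(J)` for all `t`:
  `d∕dt|₀ A(k_u exp(tX)) = ((m∕2 − k)·τ + (m∕2)·conj τ)·A(k_u) + G′`, `τ = tr (denom (k_u X) (−i1))`, `m = k − 2s − l`, `G′ = d∕dt|₀ A(k_{v_t})`;
  **`hasDerivAt_shilov_kU_exp_entry`**: `v_t` is entrywise differentiable at `0` with velocity `V = denom (k_uX) (i1) − denom (k_uX) (−i1)·u`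
  (ref1 PREP-S2 §1: multiplier `p·w + q·w̄`, vector field `u(δ − u⁻¹β − u⁻¹αu + γu)`; DESIGN-S2 §3 (ii)).
The chain rule for the compact picture `v ↦ A(k_v)` along `(v_t, V)` is the consumer's one line (`HasFDerivAt.comp_hasDerivAt` with
`hasDerivAt_pi`, or the polynomial chain rule on S2-K's `Carrier`).
References: [Knapp1986, Ch. VII §1, Ch. VIII §3]; [Shimura1997, §16.4]; [LeeZhu1998, p. 5032].
HONEST LABEL: HC_CM is proved only modulo the 7 printed citations (2 remaining named inputs: hLiu418 = stmt-HodgeConjecture-24832,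
h413 = stmt-HodgeConjecture-24833) until rung 0 closes; count-neutral helper, closes no socket.
-/

set_option autoImplicit false
set_option linter.dupNamespace false

noncomputable section

open Complex Matrix NormedSpace
open scoped ComplexConjugate

namespace Summit.HodgeConjecture.HodgeConjecture.Cruxes.HLiu418.K2LiuU22CompactPicturePOperatorsExp

open Literature.NumberTheory.ModularForms.SiegelUpperHalfSpace (num denom moeb num_def denom_def moeb_def)
open Summit.HodgeConjecture.HodgeConjecture.Cruxes.HLiu418.K2LiuHermitianTubeCocycle
open Summit.HodgeConjecture.HodgeConjecture.Cruxes.HLiu418.K2LiuArchInducedTubeDefs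
open Summit.HodgeConjecture.HodgeConjecture.Cruxes.HLiu418.K2LiuArchScalarSectionCurveDerivative (exp_zero_smul_eq_one)
open Summit.HodgeConjecture.HodgeConjecture.Cruxes.HLiu418.K2LiuU22ShilovCoordinate
open Summit.HodgeConjecture.HodgeConjecture.Cruxes.HLiu418.K2LiuU22CompactPicturePOperators

variable {l : Type*} [Fintype l] [DecidableEq l]

/-! ## §1  Entrywise calculus: `exp(tX)`, the inverse, the Shilov velocity -/

/-- Entries of `t ↦ exp(tW)` are differentiable everywhere with derivative `(W · exp(tW))_{ij}` (generic rank). [Knapp1986, Ch. I §1] -/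
theorem hasDerivAt_exp_smul_entry {n : Type*} [Fintype n] [DecidableEq n] (W : Matrix n n ℂ) (t : ℝ) (i j : n) :
    HasDerivAt (fun t : ℝ => exp (t • W) i j) ((W * exp (t • W)) i j) t := by
  open scoped Matrix.Norms.Operator in
  have he : HasDerivAt (fun t : ℝ => exp (t • W)) (W * exp (t • W)) t := hasDerivAt_exp_smul_const' (𝕂 := ℝ) W t
  exact (Matrix.entryLinearMap ℝ ℂ i j).toContinuousLinearMap.hasFDerivAt.comp_hasDerivAt t he

/-- Entries of `t ↦ g · exp(tW)` are differentiable everywhere with derivative `(g · (W · exp(tW)))_{ij}`. [Knapp1986, Ch. I §1] -/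
theorem hasDerivAt_mul_exp_smul_entry {n : Type*} [Fintype n] [DecidableEq n] (g W : Matrix n n ℂ) (t : ℝ) (i j : n) :
    HasDerivAt (fun t : ℝ => (g * exp (t • W)) i j) ((g * (W * exp (t • W))) i j) t := by
  have hfun : (fun t : ℝ => (g * exp (t • W)) i j) = fun t => ∑ q, g i q * exp (t • W) q j := by
    funext u; rw [Matrix.mul_apply]
  rw [hfun, Matrix.mul_apply]
  exact HasDerivAt.fun_sum fun q _ => (hasDerivAt_exp_smul_entry W t q j).const_mul (g i q)

/-- **Entries of the inverse along an entrywise differentiable curve**: if `D_t` is entrywise differentiable at `0` with velocity `D′` and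
`D₀` is invertible, `d∕dt|₀ (D_t)⁻¹_{ij} = (−D₀⁻¹ D′ D₀⁻¹)_{ij}` (Mathlib `hasFDerivAt_ringInverse` in the `L^∞`-operator normed ring of matrices,
projected to the entry). [folklore] -/
theorem hasDerivAt_inv_entry {n : Type*} [Fintype n] [DecidableEq n] {D : ℝ → Matrix n n ℂ} {D' : Matrix n n ℂ}
    (hD : ∀ i j, HasDerivAt (fun t => D t i j) (D' i j) 0) (hu : IsUnit (D 0).det) (i j : n) :
    HasDerivAt (fun t => (D t)⁻¹ i j) ((-((D 0)⁻¹ * D' * (D 0)⁻¹)) i j) 0 := by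
  open scoped Matrix.Norms.Operator in
  have hDd : HasDerivAt D D' 0 := hasDerivAt_pi.2 fun i => hasDerivAt_pi.2 fun j => hD i j
  obtain ⟨u, hu'⟩ := (Matrix.isUnit_iff_isUnit_det _).2 hu
  have hinv := hasFDerivAt_ringInverse (𝕜 := ℝ) u
  rw [hu'] at hinv
  have hcomp := hinv.comp_hasDerivAt (0 : ℝ) hDd
  have hfun : (fun t => (D t)⁻¹ i j) =
      ⇑(LinearMap.toContinuousLinearMap (Matrix.entryLinearMap ℝ ℂ i j)) ∘ Ring.inverse ∘ D := by
    funext t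
    simp [Matrix.nonsing_inv_eq_ringInverse]
  rw [hfun]
  refine (((Matrix.entryLinearMap ℝ ℂ i j).toContinuousLinearMap.hasFDerivAt).comp_hasDerivAt (0 : ℝ) hcomp).congr_deriv ?_
  simp [ContinuousLinearMap.mulLeftRight_apply, Matrix.coe_units_inv, hu', Matrix.nonsing_inv_eq_ringInverse]
  rfl

/-- **THE SHILOV VELOCITY EXISTS**: along an entrywise differentiable curve `h_t` (velocity `H` at `0`) with `h₀ ∈ U(J)`, the Shilov coordinate
`v_t = (denom h_t (−i1))⁻¹ · denom h_t (i1)` is entrywise differentiable at `0` with velocity `D⁻⁻¹ · (W⁺ − W⁻ · v₀)`, `D⁻ = denom h₀ (−i1)`,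
`W^± = denom H (±i1)`, `v₀ = D⁻⁻¹ denom h₀ (i1)`. [Knapp1986, VII §1; LeeZhu1998, p. 5032] -/
theorem hasDerivAt_shilov_entry {h : ℝ → Matrix (l ⊕ l) (l ⊕ l) ℂ} {H : Matrix (l ⊕ l) (l ⊕ l) ℂ}
    (hh0 : (h 0)ᴴ * Matrix.J l ℂ * h 0 = Matrix.J l ℂ) (hH : ∀ i j, HasDerivAt (fun t => h t i j) (H i j) 0) (i j : l) :
    HasDerivAt (fun t => ((denom (h t) (-(I • (1 : Matrix l l ℂ))))⁻¹ * denom (h t) (I • (1 : Matrix l l ℂ))) i j)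
      (((denom (h 0) (-(I • (1 : Matrix l l ℂ))))⁻¹ *
          (denom H (I • (1 : Matrix l l ℂ)) -
            denom H (-(I • (1 : Matrix l l ℂ))) * ((denom (h 0) (-(I • (1 : Matrix l l ℂ))))⁻¹ * denom (h 0) (I • (1 : Matrix l l ℂ))))) i j) 0 := by
  have hWm : ∀ i j, HasDerivAt (fun t => denom (h t) (-(I • (1 : Matrix l l ℂ))) i j) (denom H (-(I • (1 : Matrix l l ℂ))) i j) 0 :=
    hasDerivAt_denom_entry _ hH
  have hWp : ∀ i j, HasDerivAt (fun t => denom (h t) (I • (1 : Matrix l l ℂ)) i j) (denom H (I • (1 : Matrix l l ℂ)) i j) 0 :=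
    hasDerivAt_denom_entry _ hH
  have hinv : ∀ i j, HasDerivAt (fun t => (denom (h t) (-(I • (1 : Matrix l l ℂ))))⁻¹ i j)
      ((-((denom (h 0) (-(I • (1 : Matrix l l ℂ))))⁻¹ * denom H (-(I • (1 : Matrix l l ℂ))) * (denom (h 0) (-(I • (1 : Matrix l l ℂ))))⁻¹)) i j) 0 :=
    hasDerivAt_inv_entry (D := fun t => denom (h t) (-(I • (1 : Matrix l l ℂ)))) hWm (isUnit_det_denom_negI hh0)
  have hprod := hasDerivAt_mul_entry hinv hWp i j
  refine hprod.congr_deriv ?_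
  have key : -((denom (h 0) (-(I • (1 : Matrix l l ℂ))))⁻¹ * denom H (-(I • (1 : Matrix l l ℂ))) * (denom (h 0) (-(I • (1 : Matrix l l ℂ))))⁻¹) *
        denom (h 0) (I • (1 : Matrix l l ℂ)) + (denom (h 0) (-(I • (1 : Matrix l l ℂ))))⁻¹ * denom H (I • (1 : Matrix l l ℂ)) =
      (denom (h 0) (-(I • (1 : Matrix l l ℂ))))⁻¹ * (denom H (I • (1 : Matrix l l ℂ)) -
        denom H (-(I • (1 : Matrix l l ℂ))) * ((denom (h 0) (-(I • (1 : Matrix l l ℂ))))⁻¹ * denom (h 0) (I • (1 : Matrix l l ℂ)))) := by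
    rw [Matrix.mul_sub, Matrix.neg_mul]
    simp only [Matrix.mul_assoc]
    abel
  rw [key]

/-! ## §2  The instance `h_t = k_u · exp(tX)` -/

/-- `f⁰_{s,k}(k_u · diag(−1,1)) = 1` (`denom (k_u · diag(−1,1)) (i1) = denom k_u (−i1) = 1`). [Shimura1997, §16.4] -/
theorem archScalarSection_kU_reflect (k : ℤ) (s : ℂ) (u : Matrix l l ℂ) :
    archScalarSection k s (((2 : ℂ)⁻¹ • fromBlocks (1 + u) (-(I • (1 - u))) (I • (1 - u)) (1 + u) : Matrix (l ⊕ l) (l ⊕ l) ℂ) *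
        fromBlocks (-1) 0 0 1) = 1 := by
  rw [archScalarSection_apply, denom_mul_reflect, denom_kU_negI, det_one, _root_.one_zpow, norm_one, Complex.ofReal_one, Complex.one_cpow, mul_one]

/-- **THE LIE DERIVATIVE OF A SIEGEL SECTION AT A COMPACT-PICTURE POINT**: for `A ∈ I_w(s, χ_k)` (`χ_k(z) = (z̄∕‖z‖)^k`), unitary `u`
(`uᴴu = 1`), and `X` with `exp(tX) ∈ U(J)` for all real `t`,
`d∕dt|₀ A(k_u · exp(tX)) = ((m∕2 − k)·τ + (m∕2)·conj τ) · A(k_u) + G′`, `τ = tr (denom (k_u X) (−i1))`, `m = k − 2s − l`,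
where `G′ = d∕dt|₀ A(k_{v_t})` is the derivative of the compact picture along the Shilov coordinate `v_t` of `k_u exp(tX)` (`v₀ = u`;
velocity in `hasDerivAt_shilov_kU_exp_entry`).  [Knapp1986, VIII §3; Shimura1997, §16.4; LeeZhu1998, p. 5032] -/
theorem hasDerivAt_section_kU_exp (k : ℤ) (s : ℂ) {A : Matrix (l ⊕ l) (l ⊕ l) ℂ → ℂ}
    (hA : IsArchSiegelSection (fun z : ℂ => (conj z / ((‖z‖ : ℝ) : ℂ)) ^ k) s A) {u : Matrix l l ℂ} (hu : uᴴ * u = 1)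
    (X : Matrix (l ⊕ l) (l ⊕ l) ℂ) (hX : ∀ t : ℝ, (exp (t • X))ᴴ * Matrix.J l ℂ * exp (t • X) = Matrix.J l ℂ) {G' : ℂ}
    (hG : HasDerivAt (fun t : ℝ => A ((2 : ℂ)⁻¹ • fromBlocks
        (1 + (denom (((2 : ℂ)⁻¹ • fromBlocks (1 + u) (-(I • (1 - u))) (I • (1 - u)) (1 + u) : Matrix (l ⊕ l) (l ⊕ l) ℂ) * exp (t • X))
            (-(I • (1 : Matrix l l ℂ))))⁻¹ *
          denom (((2 : ℂ)⁻¹ • fromBlocks (1 + u) (-(I • (1 - u))) (I • (1 - u)) (1 + u) : Matrix (l ⊕ l) (l ⊕ l) ℂ) * exp (t • X))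
            (I • (1 : Matrix l l ℂ)))
        (-(I • (1 - (denom (((2 : ℂ)⁻¹ • fromBlocks (1 + u) (-(I • (1 - u))) (I • (1 - u)) (1 + u) : Matrix (l ⊕ l) (l ⊕ l) ℂ) * exp (t • X))
            (-(I • (1 : Matrix l l ℂ))))⁻¹ *
          denom (((2 : ℂ)⁻¹ • fromBlocks (1 + u) (-(I • (1 - u))) (I • (1 - u)) (1 + u) : Matrix (l ⊕ l) (l ⊕ l) ℂ) * exp (t • X))
            (I • (1 : Matrix l l ℂ)))))
        (I • (1 - (denom (((2 : ℂ)⁻¹ • fromBlocks (1 + u) (-(I • (1 - u))) (I • (1 - u)) (1 + u) : Matrix (l ⊕ l) (l ⊕ l) ℂ) * exp (t • X))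
            (-(I • (1 : Matrix l l ℂ))))⁻¹ *
          denom (((2 : ℂ)⁻¹ • fromBlocks (1 + u) (-(I • (1 - u))) (I • (1 - u)) (1 + u) : Matrix (l ⊕ l) (l ⊕ l) ℂ) * exp (t • X))
            (I • (1 : Matrix l l ℂ))))
        (1 + (denom (((2 : ℂ)⁻¹ • fromBlocks (1 + u) (-(I • (1 - u))) (I • (1 - u)) (1 + u) : Matrix (l ⊕ l) (l ⊕ l) ℂ) * exp (t • X))
            (-(I • (1 : Matrix l l ℂ))))⁻¹ *
          denom (((2 : ℂ)⁻¹ • fromBlocks (1 + u) (-(I • (1 - u))) (I • (1 - u)) (1 + u) : Matrix (l ⊕ l) (l ⊕ l) ℂ) * exp (t • X))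
            (I • (1 : Matrix l l ℂ))))) G' 0) :
    HasDerivAt (fun t : ℝ => A (((2 : ℂ)⁻¹ • fromBlocks (1 + u) (-(I • (1 - u))) (I • (1 - u)) (1 + u) : Matrix (l ⊕ l) (l ⊕ l) ℂ) * exp (t • X)))
      (((((k : ℂ) - 2 * s - (Fintype.card l : ℂ)) / 2 - k) *
            (denom (((2 : ℂ)⁻¹ • fromBlocks (1 + u) (-(I • (1 - u))) (I • (1 - u)) (1 + u) : Matrix (l ⊕ l) (l ⊕ l) ℂ) * X)
              (-(I • (1 : Matrix l l ℂ)))).trace +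
          ((k : ℂ) - 2 * s - (Fintype.card l : ℂ)) / 2 *
            conj (denom (((2 : ℂ)⁻¹ • fromBlocks (1 + u) (-(I • (1 - u))) (I • (1 - u)) (1 + u) : Matrix (l ⊕ l) (l ⊕ l) ℂ) * X)
              (-(I • (1 : Matrix l l ℂ)))).trace) *
          A ((2 : ℂ)⁻¹ • fromBlocks (1 + u) (-(I • (1 - u))) (I • (1 - u)) (1 + u)) + G') 0 := by
  set kU : Matrix (l ⊕ l) (l ⊕ l) ℂ := (2 : ℂ)⁻¹ • fromBlocks (1 + u) (-(I • (1 - u))) (I • (1 - u)) (1 + u) with hkU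
  have hk : kUᴴ * Matrix.J l ℂ * kU = Matrix.J l ℂ := kU_mem_UJ hu
  have hh : ∀ t : ℝ, (kU * exp (t • X))ᴴ * Matrix.J l ℂ * (kU * exp (t • X)) = Matrix.J l ℂ := fun t => mul_mem_UJ hk (hX t)
  have hH : ∀ t i j, HasDerivAt (fun t : ℝ => (kU * exp (t • X)) i j) ((kU * (X * exp (t • X))) i j) t :=
    fun t i j => hasDerivAt_mul_exp_smul_entry kU X t i j
  have hmain := hasDerivAt_section_comp_curve_chiK k s hA (h := fun t : ℝ => kU * exp (t • X)) (h' := fun t : ℝ => kU * (X * exp (t • X))) hh hH hG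
  refine hmain.congr_deriv ?_
  simp only [exp_zero_smul_eq_one, Matrix.mul_one]
  rw [hkU, archScalarSection_kU_reflect, denom_kU_negI, denom_kU_I, Matrix.inv_eq_left_inv (Matrix.one_mul (1 : Matrix l l ℂ))]
  simp only [one_mul]

/-- **THE SHILOV VELOCITY AT A COMPACT-PICTURE POINT**: for unitary `u` and any `X`, the Shilov coordinate `v_t` of `k_u · exp(tX)` is entrywise
differentiable at `0` with `v₀ = u` and velocity `V = denom (k_u X) (i1) − denom (k_u X) (−i1) · u` (the quadratic vector field of the compact
picture). [Knapp1986, VII §1; LeeZhu1998, p. 5032] -/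
theorem hasDerivAt_shilov_kU_exp_entry {u : Matrix l l ℂ} (hu : uᴴ * u = 1) (X : Matrix (l ⊕ l) (l ⊕ l) ℂ) (i j : l) :
    HasDerivAt (fun t : ℝ =>
        ((denom (((2 : ℂ)⁻¹ • fromBlocks (1 + u) (-(I • (1 - u))) (I • (1 - u)) (1 + u) : Matrix (l ⊕ l) (l ⊕ l) ℂ) * exp (t • X))
              (-(I • (1 : Matrix l l ℂ))))⁻¹ *
          denom (((2 : ℂ)⁻¹ • fromBlocks (1 + u) (-(I • (1 - u))) (I • (1 - u)) (1 + u) : Matrix (l ⊕ l) (l ⊕ l) ℂ) * exp (t • X))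
            (I • (1 : Matrix l l ℂ))) i j)
      ((denom (((2 : ℂ)⁻¹ • fromBlocks (1 + u) (-(I • (1 - u))) (I • (1 - u)) (1 + u) : Matrix (l ⊕ l) (l ⊕ l) ℂ) * X) (I • (1 : Matrix l l ℂ)) -
          denom (((2 : ℂ)⁻¹ • fromBlocks (1 + u) (-(I • (1 - u))) (I • (1 - u)) (1 + u) : Matrix (l ⊕ l) (l ⊕ l) ℂ) * X)
              (-(I • (1 : Matrix l l ℂ))) * u) i j) 0 := by
  set kU : Matrix (l ⊕ l) (l ⊕ l) ℂ := (2 : ℂ)⁻¹ • fromBlocks (1 + u) (-(I • (1 - u))) (I • (1 - u)) (1 + u) with hkU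
  have hk : kUᴴ * Matrix.J l ℂ * kU = Matrix.J l ℂ := kU_mem_UJ hu
  have h0 : (kU * exp ((0 : ℝ) • X))ᴴ * Matrix.J l ℂ * (kU * exp ((0 : ℝ) • X)) = Matrix.J l ℂ := by
    rw [exp_zero_smul_eq_one, Matrix.mul_one]; exact hk
  have hH : ∀ i j, HasDerivAt (fun t : ℝ => (kU * exp (t • X)) i j) ((kU * X) i j) 0 := fun i j => by
    have h := hasDerivAt_mul_exp_smul_entry kU X 0 i j
    rw [exp_zero_smul_eq_one, Matrix.mul_one] at h
    exact h
  have hmain := hasDerivAt_shilov_entry (h := fun t : ℝ => kU * exp (t • X)) h0 hH i j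
  refine hmain.congr_deriv ?_
  simp only [exp_zero_smul_eq_one, Matrix.mul_one]
  rw [hkU, denom_kU_negI, denom_kU_I, Matrix.inv_eq_left_inv (Matrix.one_mul (1 : Matrix l l ℂ))]
  simp only [Matrix.one_mul]

end Summit.HodgeConjecture.HodgeConjecture.Cruxes.HLiu418.K2LiuU22CompactPicturePOperatorsExp

end
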